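import Literature.LinearAlgebra.Matrix.SylvesterInertiaLDL
import Literature.Analysis.ValidatedNumerics.SymmetricEigenCertificate
import HarnessLib

/-!
# Kernel-checkable eigenvalue-COUNT certificates for symmetric interval families
# (spectrum slicing at a cut `c` by two exact `LDLᵀ` inertias at `c ∓ ρ`)

Topic `Literature/Analysis/ValidatedNumerics`. The CHECKER layer for the "sym-inertia" certificate
kind, in the format of `SymmetricEigenCertificate.lean` (closed Boolean functions of literal
rational lists, decided by `decide` / `decide +kernel`): given a rational centre `C`, radii `Δ`
(the family is every real SYMMETRIC `A` with `|A i j − C i j| ≤ Δ i j`), a cut `c`, a radius bound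
`ρ`, a count `ν` and two exact unit-lower-triangular factorisations
`C − (c − ρ)·1 = L₁·diag(d₁)·L₁ᵀ`, `C − (c + ρ)·1 = L₂·diag(d₂)·L₂ᵀ`, the checker `checkInertia`
verifies in exact rational arithmetic that `ρ ≥ maxᵢ Σⱼ (Δ i j + Δ j i)/2`, that both congruences
hold entrywise, that `L₁`, `L₂` are unit lower triangular, that no pivot of `d₂` vanishes and that
`d₁` and `d₂` both have exactly `ν` negative entries. SOUNDNESS
(`card_eigenvalues_lt_eq_of_checkInertia`): every symmetric `A` of the family has exactly `ν`
eigenvalues `< c` (Mathlib's `hA.eigenvalues`, with multiplicity) and `c` is not an eigenvalue.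
Two passing certificates at cuts `a ≤ b` give the number of eigenvalues in `(a, b)`
(`card_eigenvalues_btwn_of_checkInertia`); equal counts give an eigenvalue-free window `[a, b]`
(`forall_eigenvalues_not_mem_Icc_of_checkInertia`, the spectral-GAP certificate).

The mathematics is Golub–Van Loan, *Matrix Computations* (4th ed.) [GolubVanLoan2013], §8.4.2
(p. 466: "if `A − μI = LDLᵀ` … the number of negative `dᵢ` equals the number of `λᵢ(A)` that are
less than `μ`", Sylvester's law of inertia Thm 8.1.17) with Weyl's perturbation bound (§8.1.2
Cor. 8.1.6) and the Schur-test `2`-norm estimate (§2.3.3 Cor. 2.3.2) for the interval family — ALL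
ALREADY PROVED in the tree as
`Literature.LinearAlgebra.Matrix.card_eigenvalues_lt_eq_of_ldl_pair_of_entry_bounds`
(`Literature/LinearAlgebra/Matrix/SylvesterInertiaLDL.lean`); this file adds only the rational
data format, the Boolean checker and the cast bookkeeping from `List (List ℚ)` literals to
`Matrix (Fin n) (Fin n) ℝ`, exactly as `SymmetricEigenCertificate` / `MatrixEigenEnclosure` do for
the lower/upper kinds. It is the kernel statement instantiated by an exact-rational "inertia"
certificate of a validated-numerics library (unpivoted exact `LDLᵀ` of the two shifted centres,
`ρ` = the maximal symmetrised radius row sum; a cut hitting a zero pivot is moved, not certified).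

## Certificate format

* CLAIM data: `n`, centre `C : List (List ℚ)`, radii `Δ : List (List ℚ)` (as in `checkLower`);
* `InertiaCert = ⟨c, ρ, ν, L₁, d₁, L₂, d₂⟩`: cut `c : ℚ`, radius bound `ρ : ℚ`, count `ν : ℕ`,
  factors `L₁ L₂ : List (List ℚ)` (`n` rows of `n`, unit lower triangular) and pivots
  `d₁ d₂ : List ℚ` (`n` entries) with `C − (c ∓ ρ)·1 = L·diag(d)·Lᵀ` EXACTLY.

## What is NOT certified

Nothing is claimed for non-symmetric members of the family, nor for cuts other than `c`; the
count is of Mathlib's eigenvalue enumeration `hA.eigenvalues : Fin n → ℝ` (with multiplicity);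
producing the factorisations (floating point or exact) is outside the statement — only the exact
identities are checked.

## References

* [GolubVanLoan2013] G. H. Golub, C. F. Van Loan, *Matrix Computations*, 4th ed. (2013), §8.4.2,
  §8.1.5 Thm 8.1.17, §8.1.2 Cor. 8.1.6, §2.3.3 Cor. 2.3.2.
-/

open Finset Matrix

namespace Literature.Analysis.ValidatedNumerics

/-! ### The certificate and its checker -/

/-- An eigenvalue-count ("inertia") certificate for a symmetric interval family at one cut:
cut `c`, radius bound `ρ`, the claimed number `ν` of eigenvalues below `c`, and the two exact
factorisations `C − (c − ρ)·1 = L₁·diag(d₁)·L₁ᵀ`, `C − (c + ρ)·1 = L₂·diag(d₂)·L₂ᵀ`.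
[cite: GolubVanLoan2013, §8.4.2 (p. 466)] -/
structure InertiaCert where
  /-- the cut -/
  c : ℚ
  /-- radius bound, `≥ maxᵢ Σⱼ (Δ i j + Δ j i)/2` -/
  ρ : ℚ
  /-- the claimed number of eigenvalues `< c` -/
  ν : ℕ
  /-- unit lower triangular factor of `C − (c − ρ)·1`, `n` rows of `n` -/
  L₁ : List (List ℚ)
  /-- pivots of `C − (c − ρ)·1`, `n` entries -/
  d₁ : List ℚ
  /-- unit lower triangular factor of `C − (c + ρ)·1`, `n` rows of `n` -/
  L₂ : List (List ℚ)
  /-- pivots of `C − (c + ρ)·1`, `n` entries (none may vanish) -/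
  d₂ : List ℚ
  deriving DecidableEq, Inhabited

/-- Entry `(i, j)` of `L·diag(d)·Lᵀ` for tabulated rational data: `Σ_{m<n} L i m · d m · L j m`.
[folklore] -/
def congrEntryQ (n : ℕ) (L : List (List ℚ)) (d : List ℚ) (i j : ℕ) : ℚ :=
  rsum n fun m ↦ mget L i m * vget d m * mget L j m

/-- Exact check of the congruence `C − s·1 = L·diag(d)·Lᵀ` on the `n × n` block. [folklore] -/
def checkCongrQ (n : ℕ) (C : List (List ℚ)) (s : ℚ) (L : List (List ℚ)) (d : List ℚ) : Bool :=
  rall n fun i ↦ rall n fun j ↦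
    decide (mget C i j - (if i = j then s else 0) = congrEntryQ n L d i j)

/-- `L` is unit lower triangular on the `n × n` block (ones on the diagonal, zeros above).
[folklore] -/
def unitLowerQ (n : ℕ) (L : List (List ℚ)) : Bool :=
  rall n fun i ↦ decide (mget L i i = 1) && rall n fun j ↦ decide (i < j → mget L i j = 0)

/-- Number of negative entries among the first `n` of a rational list. [folklore] -/
def negCountQ (n : ℕ) (d : List ℚ) : ℕ :=
  rsum n fun m ↦ if vget d m < 0 then 1 else 0

/-- **The inertia checker**: `ρ` dominates every symmetrised radius row sum, `L₁`, `L₂` are unit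
lower triangular, both shifted congruences hold exactly, no pivot of `d₂` vanishes, and `d₁`, `d₂`
have exactly `ν` negative entries each. [cite: GolubVanLoan2013, §8.4.2 (p. 466)] -/
def checkInertia (n : ℕ) (C Δ : List (List ℚ)) (c : InertiaCert) : Bool :=
  rall n (fun i ↦ decide (radRowQ n Δ i ≤ c.ρ)) &&
    unitLowerQ n c.L₁ && unitLowerQ n c.L₂ &&
    checkCongrQ n C (c.c - c.ρ) c.L₁ c.d₁ && checkCongrQ n C (c.c + c.ρ) c.L₂ c.d₂ &&
    rall n (fun m ↦ decide (vget c.d₂ m ≠ 0)) &&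
    decide (negCountQ n c.d₁ = c.ν) && decide (negCountQ n c.d₂ = c.ν)

/-! ### Reading the rational data as real `Fin n`-indexed matrices -/

/-- A rational table read as a real `n × n` matrix on `Fin n`. [folklore] -/
def finMat (n : ℕ) (A : List (List ℚ)) : Matrix (Fin n) (Fin n) ℝ :=
  Matrix.of fun i j ↦ mreal A i j

/-- A rational list read as a real vector on `Fin n`. [folklore] -/
def finVec (n : ℕ) (v : List ℚ) : Fin n → ℝ := fun i ↦ vreal v i

/-- Entries of `finMat`. [folklore] -/
@[simp] private theorem finMat_apply (n : ℕ) (A : List (List ℚ)) (i j : Fin n) :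
    finMat n A i j = mreal A i j := rfl

/-- Entries of `finVec`. [folklore] -/
@[simp] private theorem finVec_apply (n : ℕ) (v : List ℚ) (i : Fin n) :
    finVec n v i = vreal v i := rfl

/-- A unit lower triangular rational table is a nonsingular real matrix (`det = 1`). [folklore] -/
private theorem isUnit_det_finMat_of_unitLowerQ {n : ℕ} {L : List (List ℚ)}
    (h : unitLowerQ n L = true) : IsUnit (finMat n L).det := by
  unfold unitLowerQ at h
  have hrow := fun (i : Fin n) ↦ of_rall h i.isLt
  have hdiag : ∀ i : Fin n, finMat n L i i = 1 := fun i ↦ by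
    have h1 := hrow i
    simp only [Bool.and_eq_true, decide_eq_true_eq] at h1
    rw [finMat_apply]; unfold mreal; rw [h1.1]; push_cast; rfl
  have htri : (finMat n L).BlockTriangular OrderDual.toDual := by
    intro i j hij
    have hij' : (i : ℕ) < (j : ℕ) := by
      have : i < j := OrderDual.toDual_lt_toDual.1 hij
      exact this
    have h1 := hrow i
    simp only [Bool.and_eq_true, decide_eq_true_eq] at h1
    have h2 := of_rall h1.2 j.isLt
    rw [decide_eq_true_eq] at h2
    rw [finMat_apply]; unfold mreal; rw [h2 hij']; push_cast; rfl
  rw [Matrix.det_of_lowerTriangular _ htri, Finset.prod_eq_one fun i _ ↦ hdiag i]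
  exact isUnit_one

/-- The exact congruence check gives the real matrix identity
`finMat C − s·1 = finMat L · diagonal (vreal d ·) · (finMat L)ᵀ`. [folklore] -/
private theorem finMat_sub_smul_one_eq_of_checkCongrQ {n : ℕ} {C L : List (List ℚ)} {d : List ℚ}
    {s : ℚ} (h : checkCongrQ n C s L d = true) :
    finMat n C - (s : ℝ) • (1 : Matrix (Fin n) (Fin n) ℝ)
      = finMat n L * diagonal (fun i : Fin n ↦ vreal d i) * (finMat n L)ᵀ := by
  unfold checkCongrQ at h
  ext i j
  have h1 := of_rall (of_rall h i.isLt) j.isLt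
  rw [decide_eq_true_eq] at h1
  have h2 : (mreal C i j : ℝ) - (if (i : ℕ) = j then (s : ℝ) else 0)
      = ((congrEntryQ n L d i j : ℚ) : ℝ) := by
    rw [← h1]; unfold mreal; push_cast; split_ifs <;> simp
  have h3 : ((congrEntryQ n L d i j : ℚ) : ℝ)
      = ∑ m : Fin n, mreal L i m * vreal d m * mreal L j m := by
    unfold congrEntryQ mreal vreal
    rw [rsum_eq_sum, Fin.sum_univ_eq_sum_range (fun m ↦ ((mget L i m : ℚ) : ℝ) *
      ((vget d m : ℚ) : ℝ) * ((mget L j m : ℚ) : ℝ)) n]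
    push_cast; rfl
  rw [Matrix.sub_apply, Matrix.smul_apply, Matrix.one_apply, finMat_apply, Matrix.mul_apply]
  simp only [Matrix.mul_diagonal, Matrix.transpose_apply, finMat_apply, smul_eq_mul,
    mul_ite, mul_one, mul_zero, Fin.ext_iff]
  rw [h2, h3]

/-- The negative-pivot count of the real vector is the rational `negCountQ`. [folklore] -/
private theorem card_finVec_neg_eq_negCountQ (n : ℕ) (d : List ℚ) :
    #{j : Fin n | finVec n d j < 0} = negCountQ n d := by
  rw [Finset.card_filter, negCountQ, rsum_eq_sum,
    ← Fin.sum_univ_eq_sum_range (fun m ↦ if vget d m < 0 then 1 else 0) n]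
  refine Finset.sum_congr rfl fun j _ ↦ ?_
  have hiff : finVec n d j < 0 ↔ vget d (j : ℕ) < 0 := by
    rw [finVec_apply]; unfold vreal; exact_mod_cast Iff.rfl
  by_cases hj : vget d (j : ℕ) < 0
  · rw [if_pos (hiff.2 hj), if_pos hj]
  · rw [if_neg (fun h' ↦ hj (hiff.1 h')), if_neg hj]

/-! ### Soundness -/

/-- **Soundness of the inertia checker (Golub–Van Loan §8.4.2 with Cor. 8.1.6 and Cor. 2.3.2).**
If `checkInertia n C Δ cert = true` then EVERY real symmetric `A` with `|A i j − C i j| ≤ Δ i j`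
has exactly `cert.ν` eigenvalues (Mathlib's `hA.eigenvalues`, counted with multiplicity) strictly
below the cut `cert.c`, and `cert.c` is not an eigenvalue of `A`.
[cite: GolubVanLoan2013, §8.4.2 (p. 466); §8.1.2 Cor 8.1.6; §2.3.3 Cor 2.3.2] -/
theorem card_eigenvalues_lt_eq_of_checkInertia {n : ℕ} {C Δ : List (List ℚ)} {cert : InertiaCert}
    (h : checkInertia n C Δ cert = true) {A : Matrix (Fin n) (Fin n) ℝ} (hA : A.IsHermitian)
    (hΔ : ∀ i j : Fin n, |A i j - mreal C i j| ≤ mreal Δ i j) :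
    #{i | hA.eigenvalues i < cert.c} = cert.ν ∧ ∀ i, hA.eigenvalues i ≠ cert.c := by
  unfold checkInertia at h
  simp only [Bool.and_eq_true, decide_eq_true_eq] at h
  obtain ⟨⟨⟨⟨⟨⟨⟨hρ, hL₁⟩, hL₂⟩, hc₁⟩, hc₂⟩, hd₂⟩, hν₁⟩, hν₂⟩ := h
  -- hypotheses of the tree theorem, over `𝕜 = ℝ`
  have hΔ' : ∀ i j : Fin n, ‖A i j - finMat n C i j‖ ≤ (fun i j : Fin n ↦ mreal Δ i j) i j :=
    fun i j ↦ by rw [Real.norm_eq_abs, finMat_apply]; exact hΔ i j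
  have hρ' : ∀ i : Fin n, (∑ j : Fin n, ((fun i j : Fin n ↦ mreal Δ i j) i j
      + (fun i j : Fin n ↦ mreal Δ i j) j i)) / 2 ≤ (cert.ρ : ℝ) := by
    intro i
    have h1 := of_rall hρ i.isLt
    rw [decide_eq_true_eq] at h1
    have h2 : ((radRowQ n Δ i : ℚ) : ℝ) ≤ cert.ρ := by exact_mod_cast h1
    rw [cast_radRowQ, radRow, ← Finset.sum_div,
      ← Fin.sum_univ_eq_sum_range (fun j ↦ mreal Δ i j + mreal Δ j i) n] at h2
    exact h2
  have hd₂' : ∀ j : Fin n, finVec n cert.d₂ j ≠ 0 := fun j ↦ by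
    have h1 := of_rall hd₂ j.isLt
    rw [decide_eq_true_eq] at h1
    rw [finVec_apply]; unfold vreal; exact_mod_cast h1
  have hν' : #{j : Fin n | finVec n cert.d₂ j < 0} = #{j : Fin n | finVec n cert.d₁ j < 0} := by
    rw [card_finVec_neg_eq_negCountQ, card_finVec_neg_eq_negCountQ, hν₁, hν₂]
  have key := Literature.LinearAlgebra.Matrix.card_eigenvalues_lt_eq_of_ldl_pair_of_entry_bounds
    (𝕜 := ℝ) (C := finMat n C) (L₁ := finMat n cert.L₁) (L₂ := finMat n cert.L₂)
    (Δ := fun i j : Fin n ↦ mreal Δ i j) (d₁ := finVec n cert.d₁) (d₂ := finVec n cert.d₂)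
    (c := (cert.c : ℝ)) (ρ := (cert.ρ : ℝ)) hA hΔ' hρ'
    (isUnit_det_finMat_of_unitLowerQ hL₁) (isUnit_det_finMat_of_unitLowerQ hL₂) ?_ ?_ hd₂' hν'
  · rw [card_finVec_neg_eq_negCountQ, hν₁] at key
    exact key
  · have e := finMat_sub_smul_one_eq_of_checkCongrQ hc₁
    push_cast at e
    simpa [Matrix.conjTranspose_eq_transpose_of_trivial] using e
  · have e := finMat_sub_smul_one_eq_of_checkCongrQ hc₂
    push_cast at e
    simpa [Matrix.conjTranspose_eq_transpose_of_trivial] using e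

/-- **Consecutive cuts (reading a sequence of inertia certificates, §8.4.2).** Two passing
certificates for the same family at cuts `a.c ≤ b.c` with counts `a.ν`, `b.ν`: every symmetric
`A` of the family has exactly `b.ν − a.ν` eigenvalues in the open interval `(a.c, b.c)`.
[cite: GolubVanLoan2013, §8.4.2 (p. 466); §8.4.1] -/
theorem card_eigenvalues_btwn_of_checkInertia {n : ℕ} {C Δ : List (List ℚ)} {a b : InertiaCert}
    (ha : checkInertia n C Δ a = true) (hb : checkInertia n C Δ b = true) (hab : a.c ≤ b.c)
    {A : Matrix (Fin n) (Fin n) ℝ} (hA : A.IsHermitian)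
    (hΔ : ∀ i j : Fin n, |A i j - mreal C i j| ≤ mreal Δ i j) :
    #{i | (a.c : ℝ) < hA.eigenvalues i ∧ hA.eigenvalues i < b.c} = b.ν - a.ν := by
  obtain ⟨ha1, ha2⟩ := card_eigenvalues_lt_eq_of_checkInertia ha hA hΔ
  obtain ⟨hb1, -⟩ := card_eigenvalues_lt_eq_of_checkInertia hb hA hΔ
  exact Literature.LinearAlgebra.Matrix.card_eigenvalues_btwn_of_counts hA
    (by exact_mod_cast hab) ha1 ha2 hb1

/-- **Spectral-gap certificate.** Two passing certificates at cuts `a.c ≤ b.c` with the SAME count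
`a.ν = b.ν`: no eigenvalue of any symmetric `A` of the family lies in the closed window
`[a.c, b.c]` — exactly `a.ν` eigenvalues lie below `a.c` and the other `n − a.ν` above `b.c`.
[cite: GolubVanLoan2013, §8.4.2 (p. 466); §8.4.1] -/
theorem forall_eigenvalues_not_mem_Icc_of_checkInertia {n : ℕ} {C Δ : List (List ℚ)}
    {a b : InertiaCert} (ha : checkInertia n C Δ a = true) (hb : checkInertia n C Δ b = true)
    (hab : a.c ≤ b.c) (hν : a.ν = b.ν) {A : Matrix (Fin n) (Fin n) ℝ} (hA : A.IsHermitian)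
    (hΔ : ∀ i j : Fin n, |A i j - mreal C i j| ≤ mreal Δ i j) (i : Fin n) :
    hA.eigenvalues i ∉ Set.Icc (a.c : ℝ) (b.c : ℝ) := by
  obtain ⟨-, ha2⟩ := card_eigenvalues_lt_eq_of_checkInertia ha hA hΔ
  obtain ⟨-, hb2⟩ := card_eigenvalues_lt_eq_of_checkInertia hb hA hΔ
  have h0 := card_eigenvalues_btwn_of_checkInertia ha hb hab hA hΔ
  rw [hν, Nat.sub_self, Finset.card_eq_zero, Finset.filter_eq_empty_iff] at h0
  intro hi
  rcases hi with ⟨h1, h2⟩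
  rcases lt_or_eq_of_le h1 with h1 | h1
  · rcases lt_or_eq_of_le h2 with h2 | h2
    · exact h0 (Finset.mem_univ i) ⟨h1, h2⟩
    · exact hb2 i h2
  · exact ha2 i h1.symm

/-! ### Kernel examples -/

/-- `C = [[1, 0], [0, 3]] ± 1/10` entrywise, cut `c = 2`, `ρ = 1/5`: the shifted centres
`C − (9/5)·1 = diag(−4/5, 6/5)` and `C − (11/5)·1 = diag(−6/5, 4/5)` are already diagonal
(`L = 1`), one negative pivot each — every symmetric matrix of the family has exactly one
eigenvalue below `2` and `2` is not an eigenvalue, checked by the kernel. -/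
example : checkInertia 2 [[1, 0], [0, 3]] [[1/10, 1/10], [1/10, 1/10]]
    ⟨2, 1/5, 1, [[1, 0], [0, 1]], [-4/5, 6/5], [[1, 0], [0, 1]], [-6/5, 4/5]⟩ = true := by
  decide +kernel

/-- A non-diagonal example: `C = [[0, 1], [1, 0]]` (eigenvalues `±1`), exact data, cut `c = 0`,
`ρ = 0`: `C = L·diag(d)·Lᵀ` fails unpivoted (zero leading pivot), so the cut is MOVED to
`c = 1/2`: `C − (1/2)·1 = [[−1/2, 1], [1, −1/2]] = L·diag(−1/2, 3/2)·Lᵀ` with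
`L = [[1, 0], [−2, 1]]`, one negative pivot — exactly one eigenvalue below `1/2`, checked by the
kernel. -/
example : checkInertia 2 [[0, 1], [1, 0]] [[0, 0], [0, 0]]
    ⟨1/2, 0, 1, [[1, 0], [-2, 1]], [-1/2, 3/2], [[1, 0], [-2, 1]], [-1/2, 3/2]⟩ = true := by
  decide +kernel

end Literature.Analysis.ValidatedNumerics
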